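import Literature.NumberTheory.Sieve.BombieriAsymptoticSieveLemma12
import Literature.NumberTheory.Sieve.SieveFrameworkFundamentalLemma
import HarnessLib

/-!
# Bombieri's asymptotic sieve: removing the density from the main term by oscillation

Topic `Literature/NumberTheory/Sieve`, companion file of `BombieriAsymptoticSieve.lean`
([FriedlanderIwaniecPisa1978] = Friedlander–Iwaniec, *On Bombieri's asymptotic sieve*,
Ann. SNS Pisa (4) 5 (1978); [BombieriAsymptoticSieve1976]). Everything here is PROVED (theorems
only, no new definitions, no `sorry`).

In the proof of [FriedlanderIwaniecPisa1978] Lemma 12 the main term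
`∑_{d<y,(d,P(z))=1} μ(d) g(d) (log x/d)^k` of `Σ₁` is compared with the same sum for the
density `1/d` of the integers by Lemma 9 (p. 737), which bounds `∑_d |g(d) V(z) − H P(z)/d|`
termwise using the analytic continuation hypothesis (A₅) (absolute convergence of
`∑_p |g(p) − 1/p| p^η`). The version of Bombieri's theorem recorded in `ParityBarrier.lean`
(`Literature.NumberTheory.Sieve.bombieri_asymptotic_sieve`) assumes instead only the Mertens-type asymptotic
`∑_{p ≤ x} g(p) log p = log x + c + O((log x)^{−B})` (`SieveSequence.HasLinearDensity`), under
which `∑_p |g(p) − 1/p|` may diverge. This file supplies the replacement: the comparison is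
made WITH the sign of `μ(d)`, exploiting the oscillation of `g(p) − 1/p` along the primes.

* `sub_eq_sum_primeFactors_telescope` — for multiplicative `f, g` and squarefree `d`,
  `f(d) − g(d) = ∑_{p ∣ d} g(d⁻_p)(f(p) − g(p)) f(d⁺_p)` (`d^∓_p` = product of the prime factors
  of `d` below/above `p`);
* `sum_primeFactors_split_eq_sum_triples` — the reindexing `(d, p) ↔ (d⁻_p, p, d⁺_p)`;
* `abs_sum_mul_le_of_antitone` — Abel summation of coefficients with bounded partial sums
  against a nonnegative nonincreasing weight;
* `abs_sum_moebius_mul_density_sub_inv_le` — the result: if every sum of `(g(p) − 1/p) log p`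
  over a prime-convex set of primes `≥ z` is `≤ η` in absolute value, then
  `|∑_{d<y,(d,P(z))=1} μ(d)(g(d) − 1/d)(log x/d)^k| ≤ η (log x)^k (log z)⁻¹ (∑_d |μ(d)|/d)(∑_d |μ(d)| g(d))`.

## References

* J. Friedlander, H. Iwaniec, *On Bombieri's asymptotic sieve*, Ann. Scuola Norm. Sup. Pisa
  Cl. Sci. (4) 5 (1978), 719–756, Lemma 9 and Lemma 12. [FriedlanderIwaniecPisa1978]
* E. Bombieri, *The asymptotic sieve*, Rend. Accad. Naz. XL (5) 1/2 (1975/76), 243–269.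
  [BombieriAsymptoticSieve1976]

## Design notes

* Namespace `Literature.BombieriSieve`; the weight is the concrete `(log x/d)^k` of Lemma 12 and the
  index set is that of `BombieriSieve.mainTermF` (`(Ico 1 ⌈y⌉₊).filter (Coprime · (P z))`).
* The hypothesis on `g` is stated in the combinatorial form actually used (sums over prime-convex
  sets of primes `≥ z`); it is derived from `HasLinearDensity` and Mertens' theorem with the prime
  number theorem error term elsewhere.
-/

open Finset
open scoped ArithmeticFunction.Moebius

noncomputable section

namespace Literature.NumberTheory.Sieve

namespace BombieriSieve

/-! ### The telescoping identity for a difference of multiplicative functions -/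

/-- **Telescoping a difference of multiplicative functions over the prime factors.** For
`f, g : ℕ → ℝ` multiplicative on coprime arguments with `f(1) = g(1) = 1` and squarefree `d`,
`f(d) − g(d) = ∑_{p ∣ d} g(d⁻_p) (f(p) − g(p)) f(d⁺_p)`, where `d⁻_p` (resp. `d⁺_p`) is the
product of the prime factors of `d` below (resp. above) `p`: switch the factors from `f` to `g`
one prime at a time, starting from the smallest. [folklore] -/
theorem sub_eq_sum_primeFactors_telescope {f g : ℕ → ℝ} (hf1 : f 1 = 1) (hg1 : g 1 = 1)
    (hf : ∀ m n : ℕ, m.Coprime n → f (m * n) = f m * f n)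
    (hg : ∀ m n : ℕ, m.Coprime n → g (m * n) = g m * g n) {d : ℕ} (hd : Squarefree d) :
    f d - g d = ∑ p ∈ d.primeFactors,
      g (∏ q ∈ d.primeFactors.filter (· < p), q) * (f p - g p) *
        f (∏ q ∈ d.primeFactors.filter (fun q => p < q), q) := by
  induction d using Nat.strong_induction_on with
  | _ d ih =>
  rcases eq_or_ne d 1 with rfl | h1
  · simp [hf1, hg1]
  have hd0 : d ≠ 0 := hd.ne_zero
  set p₀ := d.minFac with hp₀def
  set d' := d / p₀ with hd'def
  have hp₀ : p₀.Prime := Nat.minFac_prime h1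
  have hdd : d' * p₀ = d := BetaSieve.div_minFac_mul
  have hd'0 : d' ≠ 0 := by
    intro h
    rw [h, zero_mul] at hdd
    exact hd0 hdd.symm
  have hnd : ¬ p₀ ∣ d' := BetaSieve.not_minFac_dvd_div hd h1
  have hlt : ∀ q ∈ d'.primeFactors, p₀ < q := fun q hq =>
    BetaSieve.minFac_lt_of_mem_primeFactors_div hd h1 hq
  have hd'sf : Squarefree d' :=
    hd.squarefree_of_dvd (Nat.div_dvd_of_dvd (Nat.minFac_dvd d))
  have hd'lt : d' < d := Nat.div_lt_self (Nat.pos_of_ne_zero hd0) hp₀.one_lt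
  have hcop : d'.Coprime p₀ := (hp₀.coprime_iff_not_dvd.mpr hnd).symm
  have hpf : d.primeFactors = d'.primeFactors ∪ {p₀} := by
    rw [← hdd]; exact BetaSieve.primeFactors_mul_prime hp₀ hd'0
  have hp₀mem : p₀ ∉ d'.primeFactors := fun h => hnd (Nat.dvd_of_mem_primeFactors h)
  have ih' := ih d' hd'lt hd'sf
  -- products over the prime factors of `d'`
  set S := d'.primeFactors with hS
  have hprime : ∀ q ∈ S, q.Prime := fun q hq => Nat.prime_of_mem_primeFactors hq
  -- the filters of `S ∪ {p₀}`
  have hf1' : (S ∪ {p₀}).filter (· < p₀) = ∅ := by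
    refine Finset.filter_false_of_mem fun q hq => ?_
    rcases Finset.mem_union.mp hq with h | h
    · exact not_lt.mpr (hlt q h).le
    · rw [Finset.mem_singleton.mp h]; exact lt_irrefl _
  have hf2' : (S ∪ {p₀}).filter (fun q => p₀ < q) = S := by
    ext q
    simp only [Finset.mem_filter, Finset.mem_union, Finset.mem_singleton]
    constructor
    · rintro ⟨h | h, hq⟩
      · exact h
      · exact absurd (h ▸ hq) (lt_irrefl _)
    · exact fun h => ⟨Or.inl h, hlt q h⟩
  have hf3 : ∀ p ∈ S, (S ∪ {p₀}).filter (· < p) = S.filter (· < p) ∪ {p₀} := by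
    intro p hp
    ext q
    simp only [Finset.mem_filter, Finset.mem_union, Finset.mem_singleton]
    constructor
    · rintro ⟨h | h, hq⟩
      · exact Or.inl ⟨h, hq⟩
      · exact Or.inr h
    · rintro (⟨h, hq⟩ | h)
      · exact ⟨Or.inl h, hq⟩
      · exact ⟨Or.inr h, h ▸ hlt p hp⟩
  have hf4 : ∀ p ∈ S, (S ∪ {p₀}).filter (fun q => p < q) = S.filter (fun q => p < q) := by
    intro p hp
    ext q
    simp only [Finset.mem_filter, Finset.mem_union, Finset.mem_singleton]
    constructor
    · rintro ⟨h | h, hq⟩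
      · exact ⟨h, hq⟩
      · exact absurd ((hlt p hp).trans (h ▸ hq)) (lt_irrefl _)
    · rintro ⟨h, hq⟩
      exact ⟨Or.inl h, hq⟩
  -- `p₀` is coprime to the partial products of `S`
  have hcopS : ∀ T : Finset ℕ, T ⊆ S → (∏ q ∈ T, q).Coprime p₀ := by
    intro T hT
    refine Nat.Coprime.prod_left fun q hq => ?_
    have hqS := hT hq
    exact (Nat.coprime_primes (hprime q hqS) hp₀).mpr (ne_of_gt (hlt q hqS))
  have hprodS : ∏ q ∈ S, q = d' := Nat.prod_primeFactors_of_squarefree hd'sf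
  rw [hpf, Finset.sum_union (Finset.disjoint_singleton_right.mpr hp₀mem), Finset.sum_singleton,
    hf1', hf2', Finset.prod_empty, hg1, one_mul, hprodS]
  have hsum : ∑ p ∈ S, g (∏ q ∈ (S ∪ {p₀}).filter (· < p), q) * (f p - g p) *
        f (∏ q ∈ (S ∪ {p₀}).filter (fun q => p < q), q) =
      g p₀ * ∑ p ∈ S, g (∏ q ∈ S.filter (· < p), q) * (f p - g p) *
        f (∏ q ∈ S.filter (fun q => p < q), q) := by
    rw [Finset.mul_sum]
    refine Finset.sum_congr rfl fun p hp => ?_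
    rw [hf3 p hp, hf4 p hp, Finset.prod_union, Finset.prod_singleton,
      hg _ _ (hcopS _ (Finset.filter_subset _ _))]
    · ring
    · rw [Finset.disjoint_singleton_right]
      exact fun h => hp₀mem (Finset.mem_filter.mp h).1
  rw [hsum, ← ih', ← hdd, hf _ _ hcop, hg _ _ hcop]
  ring


/-! ### Splitting a squarefree number at one of its prime factors -/

/-- For squarefree `d` and `T ⊆ primeFactors d`, `∏_{q ∈ T} q ∣ d`. [folklore] -/
theorem prod_dvd_of_subset_primeFactors {d : ℕ} (hd : Squarefree d) {T : Finset ℕ}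
    (hT : T ⊆ d.primeFactors) : ∏ q ∈ T, q ∣ d := by
  calc ∏ q ∈ T, q ∣ ∏ q ∈ d.primeFactors, q := Finset.prod_dvd_prod_of_subset _ _ _ hT
    _ = d := Nat.prod_primeFactors_of_squarefree hd

/-- For squarefree `d` and a prime factor `p` of `d`:
`(∏_{q ∣ d, q < p} q) · p · (∏_{q ∣ d, q > p} q) = d`. [folklore] -/
theorem prod_lt_mul_mul_prod_gt {d p : ℕ} (hd : Squarefree d) (hp : p ∈ d.primeFactors) :
    (∏ q ∈ d.primeFactors.filter (· < p), q) * p *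
        (∏ q ∈ d.primeFactors.filter (fun q => p < q), q) = d := by
  have hsplit := Finset.prod_filter_mul_prod_filter_not d.primeFactors (fun q : ℕ => q < p)
    (fun q : ℕ => q)
  have hge : d.primeFactors.filter (fun q : ℕ => ¬ q < p) =
      {p} ∪ d.primeFactors.filter (fun q => p < q) := by
    ext q
    simp only [Finset.mem_filter, Finset.mem_union, Finset.mem_singleton, not_lt]
    constructor
    · rintro ⟨hq, hpq⟩
      rcases hpq.lt_or_eq with h | h
      · exact Or.inr ⟨hq, h⟩
      · exact Or.inl h.symm
    · rintro (h | ⟨hq, h⟩)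
      · exact ⟨h ▸ hp, h ▸ le_rfl⟩
      · exact ⟨hq, h.le⟩
  have hdisj : Disjoint ({p} : Finset ℕ) (d.primeFactors.filter (fun q => p < q)) := by
    rw [Finset.disjoint_singleton_left]
    intro h
    exact lt_irrefl p (Finset.mem_filter.mp h).2
  rw [hge, Finset.prod_union hdisj, Finset.prod_singleton] at hsplit
  calc (∏ q ∈ d.primeFactors.filter (· < p), q) * p *
        (∏ q ∈ d.primeFactors.filter (fun q => p < q), q)
      = (∏ q ∈ d.primeFactors.filter (· < p), q) *
          (p * ∏ q ∈ d.primeFactors.filter (fun q => p < q), q) := by ring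
    _ = ∏ q ∈ d.primeFactors, q := hsplit
    _ = d := Nat.prod_primeFactors_of_squarefree hd

/-- Prime factors of `a p b` below `p`, when the prime factors of `a` are `< p` and those of `b`
are `> p`: they are the prime factors of `a`. [folklore] -/
theorem primeFactors_mul_filter_lt {a b p : ℕ} (hp : p.Prime) (ha : a ≠ 0) (hb : b ≠ 0)
    (hap : ∀ q ∈ a.primeFactors, q < p) (hbp : ∀ q ∈ b.primeFactors, p < q) :
    (a * p * b).primeFactors.filter (· < p) = a.primeFactors := by
  ext q
  rw [Finset.mem_filter, Nat.primeFactors_mul (mul_ne_zero ha hp.ne_zero) hb,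
    Nat.primeFactors_mul ha hp.ne_zero, hp.primeFactors, Finset.mem_union, Finset.mem_union,
    Finset.mem_singleton]
  constructor
  · rintro ⟨(h | h) | h, hq⟩
    · exact h
    · exact absurd (h ▸ hq) (lt_irrefl _)
    · exact absurd ((hbp q h).trans hq) (lt_irrefl _)
  · exact fun h => ⟨Or.inl (Or.inl h), hap q h⟩

/-- Prime factors of `a p b` above `p` (same hypotheses): those of `b`. [folklore] -/
theorem primeFactors_mul_filter_gt {a b p : ℕ} (hp : p.Prime) (ha : a ≠ 0) (hb : b ≠ 0)
    (hap : ∀ q ∈ a.primeFactors, q < p) (hbp : ∀ q ∈ b.primeFactors, p < q) :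
    (a * p * b).primeFactors.filter (fun q => p < q) = b.primeFactors := by
  ext q
  rw [Finset.mem_filter, Nat.primeFactors_mul (mul_ne_zero ha hp.ne_zero) hb,
    Nat.primeFactors_mul ha hp.ne_zero, hp.primeFactors, Finset.mem_union, Finset.mem_union,
    Finset.mem_singleton]
  constructor
  · rintro ⟨(h | h) | h, hq⟩
    · exact absurd ((hap q h).trans hq) (lt_irrefl _)
    · exact absurd (h ▸ hq) (lt_irrefl _)
    · exact h
  · exact fun h => ⟨Or.inr h, hbp q h⟩

/-- **Reindexing by the split `d = a · p · b`.** Let `𝒟 = {1 ≤ d < Y : (d, P) = 1, d squarefree}`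
and let `𝒯` be the set of triples `((a, b), p)` with `a, b ∈ 𝒟`, `p < Y` prime with `(p, P) = 1`,
all prime factors of `a` below `p`, all prime factors of `b` above `p`, and `a p b < Y`. Then
`(d, p) ↦ ((d⁻_p, d⁺_p), p)` (`p` a prime factor of `d`) is a bijection onto `𝒯` with inverse
`((a, b), p) ↦ (a p b, p)`, so that for every `F`,
`∑_{d ∈ 𝒟} ∑_{p ∣ d} F(d⁻_p, p, d⁺_p) = ∑_{((a,b),p) ∈ 𝒯} F(a, p, b)`. [folklore] -/
theorem sum_primeFactors_split_eq_sum_triples (P Y : ℕ) (F : ℕ → ℕ → ℕ → ℝ) :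
    ∑ d ∈ (Ico 1 Y).filter (fun d : ℕ => d.Coprime P ∧ Squarefree d),
        ∑ p ∈ d.primeFactors,
          F (∏ q ∈ d.primeFactors.filter (· < p), q) p
            (∏ q ∈ d.primeFactors.filter (fun q => p < q), q) =
      ∑ t ∈ ((((Ico 1 Y).filter (fun d : ℕ => d.Coprime P ∧ Squarefree d)) ×ˢ
              ((Ico 1 Y).filter (fun d : ℕ => d.Coprime P ∧ Squarefree d))) ×ˢ
              ((Finset.range Y).filter (fun p : ℕ => p.Prime ∧ p.Coprime P))).filter
            (fun t : (ℕ × ℕ) × ℕ => (∀ q ∈ t.1.1.primeFactors, q < t.2) ∧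
              (∀ q ∈ t.1.2.primeFactors, t.2 < q) ∧ t.1.1 * t.2 * t.1.2 < Y),
        F t.1.1 t.2 t.1.2 := by
  set D := (Ico 1 Y).filter (fun d : ℕ => d.Coprime P ∧ Squarefree d) with hD
  set Pr := (Finset.range Y).filter (fun p : ℕ => p.Prime ∧ p.Coprime P) with hPr
  have hmemD : ∀ {d : ℕ}, d ∈ D ↔ (1 ≤ d ∧ d < Y) ∧ d.Coprime P ∧ Squarefree d := by
    intro d; rw [hD, Finset.mem_filter, Finset.mem_Ico]
  rw [Finset.sum_sigma' D (fun d => d.primeFactors)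
    (fun d p => F (∏ q ∈ d.primeFactors.filter (· < p), q) p
      (∏ q ∈ d.primeFactors.filter (fun q => p < q), q))]
  refine Finset.sum_nbij'
    (fun s : (Σ _ : ℕ, ℕ) => ((∏ q ∈ s.1.primeFactors.filter (· < s.2), q,
        ∏ q ∈ s.1.primeFactors.filter (fun q => s.2 < q), q), s.2))
    (fun t : (ℕ × ℕ) × ℕ => ⟨t.1.1 * t.2 * t.1.2, t.2⟩) ?_ ?_ ?_ ?_ ?_
  · -- `i` maps into `𝒯`
    rintro ⟨d, p⟩ hs
    rw [Finset.mem_sigma] at hs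
    obtain ⟨hd, hp⟩ := hs
    dsimp only at hd hp ⊢
    obtain ⟨⟨hd1, hdY⟩, hdP, hdsf⟩ := hmemD.mp hd
    have hpp : p.Prime := Nat.prime_of_mem_primeFactors hp
    have hpd : p ∣ d := Nat.dvd_of_mem_primeFactors hp
    have hsub1 : d.primeFactors.filter (· < p) ⊆ d.primeFactors := Finset.filter_subset _ _
    have hsub2 : d.primeFactors.filter (fun q => p < q) ⊆ d.primeFactors :=
      Finset.filter_subset _ _
    have hdvd1 := prod_dvd_of_subset_primeFactors hdsf hsub1
    have hdvd2 := prod_dvd_of_subset_primeFactors hdsf hsub2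
    have hprimes : ∀ q ∈ d.primeFactors, q.Prime := fun q hq => Nat.prime_of_mem_primeFactors hq
    have hpf1 := Nat.primeFactors_prod (fun q hq => hprimes q (hsub1 hq))
    have hpf2 := Nat.primeFactors_prod (fun q hq => hprimes q (hsub2 hq))
    have hmem_of_dvd : ∀ {e : ℕ}, e ∣ d → e ∈ D := by
      intro e he
      have he0 : e ≠ 0 := fun h => hdsf.ne_zero (Nat.eq_zero_of_zero_dvd (h ▸ he))
      refine hmemD.mpr ⟨⟨Nat.pos_of_ne_zero he0, lt_of_le_of_lt (Nat.le_of_dvd hd1 he) hdY⟩,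
        Nat.Coprime.coprime_dvd_left he hdP, hdsf.squarefree_of_dvd he⟩
    simp only [Finset.mem_filter, Finset.mem_product]
    refine ⟨⟨⟨hmem_of_dvd hdvd1, hmem_of_dvd hdvd2⟩, ?_⟩, ?_, ?_, ?_⟩
    · rw [hPr, Finset.mem_filter, Finset.mem_range]
      exact ⟨lt_of_le_of_lt (Nat.le_of_dvd hd1 hpd) hdY, hpp,
        Nat.Coprime.coprime_dvd_left hpd hdP⟩
    · intro q hq
      rw [hpf1] at hq
      exact (Finset.mem_filter.mp hq).2
    · intro q hq
      rw [hpf2] at hq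
      exact (Finset.mem_filter.mp hq).2
    · rw [prod_lt_mul_mul_prod_gt hdsf hp]; exact hdY
  · -- `j` maps into the pairs
    rintro ⟨⟨a, b⟩, p⟩ ht
    rw [Finset.mem_filter, Finset.mem_product, Finset.mem_product] at ht
    obtain ⟨⟨⟨ha, hb⟩, hp⟩, hap, hbp, hY⟩ := ht
    dsimp only at ha hb hp hap hbp hY ⊢
    obtain ⟨⟨ha1, -⟩, haP, hasf⟩ := hmemD.mp ha
    obtain ⟨⟨hb1, -⟩, hbP, hbsf⟩ := hmemD.mp hb
    rw [hPr, Finset.mem_filter] at hp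
    obtain ⟨-, hpp, hpP⟩ := hp
    have ha0 : a ≠ 0 := by omega
    have hb0 : b ≠ 0 := by omega
    have hpa : a.Coprime p := by
      refine (hpp.coprime_iff_not_dvd.mpr fun h => ?_).symm
      exact lt_irrefl p (hap p (Nat.mem_primeFactors.mpr ⟨hpp, h, ha0⟩))
    have hpb : p.Coprime b := by
      refine hpp.coprime_iff_not_dvd.mpr fun h => ?_
      exact lt_irrefl p (hbp p (Nat.mem_primeFactors.mpr ⟨hpp, h, hb0⟩))
    have hab : a.Coprime b := by
      refine Nat.Coprime.symm (Nat.coprime_of_dvd fun q hq hqb hqa => ?_)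
      have h1 := hap q (Nat.mem_primeFactors.mpr ⟨hq, hqa, ha0⟩)
      have h2 := hbp q (Nat.mem_primeFactors.mpr ⟨hq, hqb, hb0⟩)
      exact lt_irrefl _ (h1.trans h2)
    rw [Finset.mem_sigma]
    refine ⟨hmemD.mpr ⟨⟨?_, hY⟩, ?_, ?_⟩, ?_⟩
    · exact Nat.pos_of_ne_zero (mul_ne_zero (mul_ne_zero ha0 hpp.ne_zero) hb0)
    · exact Nat.Coprime.mul_left (Nat.Coprime.mul_left haP hpP) hbP
    · rw [Nat.squarefree_mul_iff, Nat.squarefree_mul_iff]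
      exact ⟨Nat.Coprime.mul_left hab hpb, ⟨hpa, hasf, hpp.squarefree⟩, hbsf⟩
    · exact Nat.mem_primeFactors.mpr ⟨hpp, ⟨b * a, by ring⟩,
        mul_ne_zero (mul_ne_zero ha0 hpp.ne_zero) hb0⟩
  · -- `j ∘ i = id`
    rintro ⟨d, p⟩ hs
    rw [Finset.mem_sigma] at hs
    obtain ⟨hd, hp⟩ := hs
    dsimp only at hd hp ⊢
    obtain ⟨-, -, hdsf⟩ := hmemD.mp hd
    rw [prod_lt_mul_mul_prod_gt hdsf hp]
  · -- `i ∘ j = id`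
    rintro ⟨⟨a, b⟩, p⟩ ht
    rw [Finset.mem_filter, Finset.mem_product, Finset.mem_product] at ht
    obtain ⟨⟨⟨ha, hb⟩, hp⟩, hap, hbp, -⟩ := ht
    dsimp only at ha hb hp hap hbp ⊢
    obtain ⟨⟨ha1, -⟩, -, hasf⟩ := hmemD.mp ha
    obtain ⟨⟨hb1, -⟩, -, hbsf⟩ := hmemD.mp hb
    rw [hPr, Finset.mem_filter] at hp
    obtain ⟨-, hpp, -⟩ := hp
    have ha0 : a ≠ 0 := by omega
    have hb0 : b ≠ 0 := by omega
    rw [primeFactors_mul_filter_lt hpp ha0 hb0 hap hbp,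
      primeFactors_mul_filter_gt hpp ha0 hb0 hap hbp,
      Nat.prod_primeFactors_of_squarefree hasf, Nat.prod_primeFactors_of_squarefree hbsf]
  · -- the summands agree
    rintro ⟨d, p⟩ _
    rfl


/-! ### Abel summation over a set of integers against an antitone weight -/

/-- **Abel summation against an antitone weight.** Let `S` be a finite set of integers `≥ m₀ ≥ 1`,
`c` coefficients all of whose partial sums over `S` are bounded by `η` in absolute value, and
`ψ ≥ 0` nonincreasing on `[m₀, ∞)`. Then `|∑_{p ∈ S} c(p) ψ(p)| ≤ η ψ(m₀)`. [folklore] -/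
theorem abs_sum_mul_le_of_antitone {S : Finset ℕ} {c ψ : ℕ → ℝ} {η : ℝ} {m₀ : ℕ} (hm₀ : 1 ≤ m₀)
    (hS : ∀ p ∈ S, m₀ ≤ p) (hE : ∀ m : ℕ, |∑ p ∈ S.filter (· ≤ m), c p| ≤ η)
    (hψ : ∀ m n : ℕ, m₀ ≤ m → m ≤ n → ψ n ≤ ψ m) (hψ0 : ∀ n, m₀ ≤ n → 0 ≤ ψ n) :
    |∑ p ∈ S, c p * ψ p| ≤ η * ψ m₀ := by
  have hη0 : 0 ≤ η := le_trans (abs_nonneg _) (hE 0)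
  rcases S.eq_empty_or_nonempty with rfl | hne
  · rw [Finset.sum_empty, abs_zero]; exact mul_nonneg hη0 (hψ0 m₀ le_rfl)
  set N := S.sup id with hN
  obtain ⟨p₁, hp₁⟩ := hne
  have hm₀N : m₀ ≤ N := (hS p₁ hp₁).trans (Finset.le_sup (f := id) hp₁)
  set e : ℕ → ℝ := fun n => if n ∈ S then c n else 0 with he
  have hSsub : S ⊆ Ioc 0 N := fun p hp =>
    Finset.mem_Ioc.mpr ⟨lt_of_lt_of_le (by omega) (hS p hp), Finset.le_sup (f := id) hp⟩
  have hsum : ∑ p ∈ S, c p * ψ p = ∑ n ∈ Ioc 0 N, e n * ψ n := by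
    rw [← Finset.sum_subset hSsub (f := fun n => e n * ψ n) (fun n _ hn => by
      rw [he]; simp only; rw [if_neg hn, zero_mul])]
    exact Finset.sum_congr rfl fun n hn => by rw [he]; simp only; rw [if_pos hn]
  have hpartial : ∀ m, ∑ n ∈ Ioc 0 m, e n = ∑ p ∈ S.filter (· ≤ m), c p := by
    intro m
    rw [he, ← Finset.sum_filter]
    refine Finset.sum_congr ?_ fun _ _ => rfl
    ext n
    simp only [Finset.mem_filter, Finset.mem_Ioc]
    constructor
    · rintro ⟨⟨-, hnm⟩, hnS⟩; exact ⟨hnS, hnm⟩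
    · rintro ⟨hnS, hnm⟩; exact ⟨⟨lt_of_lt_of_le (by omega) (hS n hnS), hnm⟩, hnS⟩
  rw [hsum, sum_Ioc_mul_eq_sub_sum_range, hpartial]
  -- boundary term
  have h1 : |(∑ p ∈ S.filter (· ≤ N), c p) * ψ N| ≤ η * ψ N := by
    rw [abs_mul, abs_of_nonneg (hψ0 N hm₀N)]
    exact mul_le_mul_of_nonneg_right (hE N) (hψ0 N hm₀N)
  -- the telescoping sum
  have h2 : |∑ m ∈ Finset.range N, (∑ n ∈ Ioc 0 m, e n) * (ψ (m + 1) - ψ m)| ≤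
      η * (ψ m₀ - ψ N) := by
    refine (Finset.abs_sum_le_sum_abs _ _).trans ?_
    have hterm : ∀ m ∈ Finset.range N, |(∑ n ∈ Ioc 0 m, e n) * (ψ (m + 1) - ψ m)| ≤
        if m₀ ≤ m then η * (ψ m - ψ (m + 1)) else 0 := by
      intro m _
      rw [hpartial]
      split_ifs with hm
      · have hΔ : 0 ≤ ψ m - ψ (m + 1) := sub_nonneg.mpr (hψ m (m + 1) hm (Nat.le_succ m))
        rw [abs_mul, show |ψ (m + 1) - ψ m| = ψ m - ψ (m + 1) by
          rw [abs_sub_comm]; exact abs_of_nonneg hΔ]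
        exact mul_le_mul_of_nonneg_right (hE m) hΔ
      · have hempty : S.filter (· ≤ m) = ∅ := by
          refine Finset.filter_false_of_mem fun p hp => ?_
          have := hS p hp
          omega
        rw [hempty, Finset.sum_empty, zero_mul, abs_zero]
    refine (Finset.sum_le_sum hterm).trans (le_of_eq ?_)
    rw [Finset.sum_ite, Finset.sum_const_zero, add_zero, ← Finset.mul_sum]
    congr 1
    have hfilter : (Finset.range N).filter (fun m => m₀ ≤ m) = Finset.Ico m₀ N := by
      ext m; simp only [Finset.mem_filter, Finset.mem_range, Finset.mem_Ico]; omega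
    rw [hfilter, Finset.sum_Ico_eq_sum_range]
    have htel := Finset.sum_range_sub' (fun i => ψ (m₀ + i)) (N - m₀)
    simp only [add_zero, Nat.add_sub_cancel' hm₀N] at htel
    rw [← htel]
    exact Finset.sum_congr rfl fun i _ => by rw [add_assoc]
  calc |(∑ p ∈ S.filter (· ≤ N), c p) * ψ N -
        ∑ m ∈ Finset.range N, (∑ n ∈ Ioc 0 m, e n) * (ψ (m + 1) - ψ m)|
      ≤ |(∑ p ∈ S.filter (· ≤ N), c p) * ψ N| +
          |∑ m ∈ Finset.range N, (∑ n ∈ Ioc 0 m, e n) * (ψ (m + 1) - ψ m)| := abs_sub _ _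
    _ ≤ η * ψ N + η * (ψ m₀ - ψ N) := add_le_add h1 h2
    _ = η * ψ m₀ := by ring


/-! ### The weight `ψ_{a,b}` and coprimality from the order conditions -/

/-- `a` is coprime to a prime exceeding all prime factors of `a`. [folklore] -/
theorem coprime_of_primeFactors_lt {a p : ℕ} (hp : p.Prime) (ha : a ≠ 0)
    (hap : ∀ q ∈ a.primeFactors, q < p) : a.Coprime p := by
  refine (hp.coprime_iff_not_dvd.mpr fun h => ?_).symm
  exact lt_irrefl p (hap p (Nat.mem_primeFactors.mpr ⟨hp, h, ha⟩))

/-- A prime below all prime factors of `b` is coprime to `b`. [folklore] -/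
theorem coprime_of_lt_primeFactors {b p : ℕ} (hp : p.Prime) (hb : b ≠ 0)
    (hbp : ∀ q ∈ b.primeFactors, p < q) : p.Coprime b := by
  refine hp.coprime_iff_not_dvd.mpr fun h => ?_
  exact lt_irrefl p (hbp p (Nat.mem_primeFactors.mpr ⟨hp, h, hb⟩))

/-- If the prime factors of `a` lie below `p` and those of `b` above `p`, then `(a, b) = 1`.
[folklore] -/
theorem coprime_of_primeFactors_lt_lt {a b p : ℕ} (ha : a ≠ 0) (hb : b ≠ 0)
    (hap : ∀ q ∈ a.primeFactors, q < p) (hbp : ∀ q ∈ b.primeFactors, p < q) : a.Coprime b := by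
  refine Nat.Coprime.symm (Nat.coprime_of_dvd fun q hq hqb hqa => ?_)
  have h1 := hap q (Nat.mem_primeFactors.mpr ⟨hq, hqa, ha⟩)
  have h2 := hbp q (Nat.mem_primeFactors.mpr ⟨hq, hqb, hb⟩)
  exact lt_irrefl _ (h1.trans h2)

/-- The weight `ψ_{a,b}(n) = (log⁺ (x/(a n b)))^k / log n` is nonincreasing in `n ≥ 2`
(`a, b ≥ 1`). [folklore] -/
theorem logRatioWeight_antitone {x : ℝ} (hx : 0 < x) {a b : ℕ} (ha : 1 ≤ a) (hb : 1 ≤ b) (k : ℕ)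
    {m n : ℕ} (hm : 2 ≤ m) (hmn : m ≤ n) :
    max 0 (Real.log (x / ((a : ℝ) * n * b))) ^ k / Real.log n ≤
      max 0 (Real.log (x / ((a : ℝ) * m * b))) ^ k / Real.log m := by
  have hm2 : (2 : ℝ) ≤ m := by exact_mod_cast hm
  have hmn' : (m : ℝ) ≤ n := by exact_mod_cast hmn
  have ha' : (1 : ℝ) ≤ a := by exact_mod_cast ha
  have hb' : (1 : ℝ) ≤ b := by exact_mod_cast hb
  have hlogm : 0 < Real.log m := Real.log_pos (by linarith)
  have hlogmn : Real.log m ≤ Real.log n := Real.log_le_log (by linarith) hmn'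
  have ha0 : (0 : ℝ) < a := by linarith
  have hb0 : (0 : ℝ) < b := by linarith
  have hm0 : (0 : ℝ) < m := by linarith
  have hn0 : (0 : ℝ) < n := by linarith
  have hden_m : 0 < (a : ℝ) * m * b := by positivity
  have hnum : max 0 (Real.log (x / ((a : ℝ) * n * b))) ≤
      max 0 (Real.log (x / ((a : ℝ) * m * b))) := by
    refine max_le_max le_rfl (Real.log_le_log (by positivity) ?_)
    exact div_le_div_of_nonneg_left hx.le hden_m (by gcongr)
  have hnum0 : 0 ≤ max 0 (Real.log (x / ((a : ℝ) * n * b))) := le_max_left _ _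
  have hnumm0 : 0 ≤ max 0 (Real.log (x / ((a : ℝ) * m * b))) ^ k :=
    pow_nonneg (le_max_left _ _) _
  calc max 0 (Real.log (x / ((a : ℝ) * n * b))) ^ k / Real.log n
      ≤ max 0 (Real.log (x / ((a : ℝ) * m * b))) ^ k / Real.log n :=
        div_le_div_of_nonneg_right (pow_le_pow_left₀ hnum0 hnum k) (hlogm.trans_le hlogmn).le
    _ ≤ max 0 (Real.log (x / ((a : ℝ) * m * b))) ^ k / Real.log m :=
        div_le_div_of_nonneg_left hnumm0 hlogm hlogmn

/-- `ψ_{a,b}(m) ≤ (log x)^k / log z` for `m ≥ z ≥ 2`, `x ≥ 1`, `a, b ≥ 1`. [folklore] -/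
theorem logRatioWeight_le {x z : ℝ} (hx : 1 ≤ x) (hz : 2 ≤ z) {a b m : ℕ} (ha : 1 ≤ a) (hb : 1 ≤ b)
    (hm : z ≤ m) (k : ℕ) :
    max 0 (Real.log (x / ((a : ℝ) * m * b))) ^ k / Real.log m ≤ Real.log x ^ k / Real.log z := by
  have ha' : (1 : ℝ) ≤ a := by exact_mod_cast ha
  have hb' : (1 : ℝ) ≤ b := by exact_mod_cast hb
  have hm2 : (2 : ℝ) ≤ m := hz.trans hm
  have hlogz : 0 < Real.log z := Real.log_pos (by linarith)
  have hlogm : Real.log z ≤ Real.log m := Real.log_le_log (by linarith) hm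
  have hL : 0 ≤ Real.log x := Real.log_nonneg hx
  have hden : 1 ≤ (a : ℝ) * m * b :=
    one_le_mul_of_one_le_of_one_le (one_le_mul_of_one_le_of_one_le ha' (by linarith)) hb'
  have hnum : max 0 (Real.log (x / ((a : ℝ) * m * b))) ≤ Real.log x := by
    refine max_le hL ((Real.log_le_log (by positivity) ?_).trans le_rfl)
    exact div_le_self (by linarith) hden
  have hnum0 : 0 ≤ max 0 (Real.log (x / ((a : ℝ) * m * b))) := le_max_left _ _
  calc max 0 (Real.log (x / ((a : ℝ) * m * b))) ^ k / Real.log m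
      ≤ Real.log x ^ k / Real.log m :=
        div_le_div_of_nonneg_right (pow_le_pow_left₀ hnum0 hnum k) (hlogz.trans_le hlogm).le
    _ ≤ Real.log x ^ k / Real.log z :=
        div_le_div_of_nonneg_left (pow_nonneg hL _) hlogz hlogm

/-! ### The oscillatory form of [FriedlanderIwaniecPisa1978] Lemma 9 -/

/-- **Removing the density from the main term by oscillation** (the rôle of
[FriedlanderIwaniecPisa1978] Lemma 9, p. 737, in the proof of Lemma 12, but WITHOUT absolute
convergence of `∑_p |g(p) − 1/p|`): let `g ≥ 0` be multiplicative, `2 ≤ z`, `1 ≤ x`, `y ≤ x`, and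
suppose every sum of `(g(p) − 1/p) log p` over a set of primes `≥ z` which is convex among the
primes is at most `η` in absolute value (this holds with `η → 0` as `z → ∞` as soon as
`∑_{p ≤ t} (g(p) − 1/p) log p` converges). Then
`|∑_{d < y, (d,P(z))=1} μ(d) (g(d) − 1/d) (log x/d)^k|
   ≤ η (log x)^k (log z)⁻¹ (∑_{d} |μ(d)|/d) (∑_{d} |μ(d)| g(d))`
(both sums over the same range). Proof: telescope `g(d) − 1/d` over the prime factors of `d`
(`sub_eq_sum_primeFactors_telescope`), reindex by `d = a p b`
(`sum_primeFactors_split_eq_sum_triples`), and for fixed `(a, b)` sum over the prime `p` by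
Abel summation against the nonincreasing weight `(log x/(apb))^k / log p`
(`abs_sum_mul_le_of_antitone`). [cite: FriedlanderIwaniecPisa1978, Lemma 9 and Lemma 12 (rôle of Lemma 9)] -/
theorem abs_sum_moebius_mul_density_sub_inv_le (g : ArithmeticFunction ℝ)
    (hg : g.IsMultiplicative) (hg0 : ∀ p : ℕ, p.Prime → 0 ≤ g p) (k : ℕ) {x y z η : ℝ}
    (hz : 2 ≤ z) (hx : 1 ≤ x) (hyx : y ≤ x)
    (hη : ∀ I : Finset ℕ, (∀ p ∈ I, p.Prime ∧ z ≤ (p : ℝ)) →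
      (∀ p₁ ∈ I, ∀ p₃ ∈ I, ∀ p₂ : ℕ, p₂.Prime → p₁ ≤ p₂ → p₂ ≤ p₃ → p₂ ∈ I) →
        |∑ p ∈ I, (g p - (p : ℝ)⁻¹) * Real.log p| ≤ η) :
    |∑ d ∈ (Ico 1 ⌈y⌉₊).filter (fun d : ℕ => d.Coprime (primesProdBelow z)),
        (μ d : ℝ) * (g d - (d : ℝ)⁻¹) * Real.log (x / d) ^ k| ≤
      η * (Real.log x ^ k / Real.log z) *
        ((∑ a ∈ (Ico 1 ⌈y⌉₊).filter (fun d : ℕ => d.Coprime (primesProdBelow z)),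
            |(μ a : ℝ)| * (a : ℝ)⁻¹) *
          ∑ b ∈ (Ico 1 ⌈y⌉₊).filter (fun d : ℕ => d.Coprime (primesProdBelow z)),
            |(μ b : ℝ)| * g b) := by
  have hx0 : 0 < x := by linarith
  have hL0 : 0 ≤ Real.log x := Real.log_nonneg hx
  have hlogz : 0 < Real.log z := Real.log_pos (by linarith)
  have hη0 : 0 ≤ η := by
    have := hη ∅ (by simp) (by simp)
    simpa using this
  have hzm₀ : z ≤ (⌈z⌉₊ : ℝ) := Nat.le_ceil z
  have hm₀2 : 2 ≤ ⌈z⌉₊ := by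
    have h : (2 : ℝ) ≤ (⌈z⌉₊ : ℝ) := hz.trans hzm₀
    exact_mod_cast h
  set P := primesProdBelow z with hP
  set Y := ⌈y⌉₊ with hY
  -- the function of the triple `(a, p, b)`
  set F : ℕ → ℕ → ℕ → ℝ := fun a p b =>
    (μ (a * p * b) : ℝ) * Real.log (x / ((a * p * b : ℕ) : ℝ)) ^ k *
      (((a : ℕ) : ℝ)⁻¹ * (g p - (p : ℝ)⁻¹) * g b) with hF
  have hC := sum_primeFactors_split_eq_sum_triples P Y F
  set Ds := (Ico 1 Y).filter (fun d : ℕ => d.Coprime P ∧ Squarefree d) with hDs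
  set Pr := (Finset.range Y).filter (fun p : ℕ => p.Prime ∧ p.Coprime P) with hPr
  set D := (Ico 1 Y).filter (fun d : ℕ => d.Coprime P) with hD
  -- membership
  have hmemDs : ∀ {d : ℕ}, d ∈ Ds ↔ (1 ≤ d ∧ d < Y) ∧ d.Coprime P ∧ Squarefree d := by
    intro d; rw [hDs, Finset.mem_filter, Finset.mem_Ico]
  have hmemPr : ∀ {p : ℕ}, p ∈ Pr ↔ p < Y ∧ p.Prime ∧ p.Coprime P := by
    intro p; rw [hPr, Finset.mem_filter, Finset.mem_range]
  have hDs_sub : Ds ⊆ D := by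
    intro d hd
    rw [hD, Finset.mem_filter]
    rw [hDs, Finset.mem_filter] at hd
    exact ⟨hd.1, hd.2.1⟩
  -- a prime is coprime to `P(z)` iff it is `≥ z`
  have hcopP : ∀ {p : ℕ}, p.Prime → (p.Coprime P ↔ z ≤ (p : ℝ)) := by
    intro p hp
    rw [hP, hp.coprime_iff_not_dvd, dvd_primesProdBelow_iff hp, not_lt]
  -- `a p b < Y` gives `x / (a p b) ≥ 1`
  have hltY : ∀ {n : ℕ}, n < Y → (n : ℝ) < y := by
    intro n hn
    have h1 : (n : ℝ) ≤ ((Y - 1 : ℕ) : ℝ) := by exact_mod_cast Nat.le_sub_one_of_lt hn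
    have hY0 : 1 ≤ Y := by omega
    have h2 : ((Y - 1 : ℕ) : ℝ) < y := by
      rw [Nat.cast_sub hY0, Nat.cast_one, sub_lt_iff_lt_add, hY]
      exact Nat.ceil_lt_add_one (by
        by_contra hy
        push Not at hy
        have : Y = 0 := by rw [hY]; exact Nat.ceil_eq_zero.mpr hy.le
        omega)
    exact lt_of_le_of_lt h1 h2
  -- Step A: restrict to squarefree `d`
  have hA : ∑ d ∈ D, (μ d : ℝ) * (g d - (d : ℝ)⁻¹) * Real.log (x / d) ^ k =
      ∑ d ∈ Ds, (μ d : ℝ) * (g d - (d : ℝ)⁻¹) * Real.log (x / d) ^ k := by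
    refine (Finset.sum_subset hDs_sub fun d hd hnd => ?_).symm
    have hnsf : ¬ Squarefree d := fun hsf => hnd (by
      rw [hD, Finset.mem_filter] at hd
      rw [hDs, Finset.mem_filter]
      exact ⟨hd.1, hd.2, hsf⟩)
    rw [ArithmeticFunction.moebius_eq_zero_of_not_squarefree hnsf, Int.cast_zero, zero_mul,
      zero_mul]
  -- Step B: telescope
  have hB : ∀ d ∈ Ds, (μ d : ℝ) * (g d - (d : ℝ)⁻¹) * Real.log (x / d) ^ k =
      ∑ p ∈ d.primeFactors, F (∏ q ∈ d.primeFactors.filter (· < p), q) p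
        (∏ q ∈ d.primeFactors.filter (fun q => p < q), q) := by
    intro d hd
    have hdsf : Squarefree d := (hmemDs.mp hd).2.2
    have htel := sub_eq_sum_primeFactors_telescope (f := fun n : ℕ => g n)
      (g := fun n : ℕ => (n : ℝ)⁻¹) (by simp [hg.map_one]) (by simp)
      (fun m n hmn => hg.map_mul_of_coprime hmn) (fun m n _ => by push_cast; rw [mul_inv]) hdsf
    rw [htel, Finset.mul_sum, Finset.sum_mul]
    refine Finset.sum_congr rfl fun p hp => ?_
    rw [hF]
    simp only
    rw [prod_lt_mul_mul_prod_gt hdsf hp]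
    ring
  rw [hA, Finset.sum_congr rfl hB, hC]
  -- Step D: the triple sum as an iterated sum, and the inner sums
  set cond : ℕ × ℕ → ℕ → Prop := fun ab p =>
    (∀ q ∈ ab.1.primeFactors, q < p) ∧ (∀ q ∈ ab.2.primeFactors, p < q) ∧
      ab.1 * p * ab.2 < Y with hcond
  have hD1 : ∑ t ∈ ((Ds ×ˢ Ds) ×ˢ Pr).filter
        (fun t : (ℕ × ℕ) × ℕ => (∀ q ∈ t.1.1.primeFactors, q < t.2) ∧
          (∀ q ∈ t.1.2.primeFactors, t.2 < q) ∧ t.1.1 * t.2 * t.1.2 < Y),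
        F t.1.1 t.2 t.1.2 =
      ∑ ab ∈ Ds ×ˢ Ds, ∑ p ∈ Pr.filter (cond ab), F ab.1 p ab.2 := by
    rw [Finset.sum_filter, Finset.sum_product]
    refine Finset.sum_congr rfl fun ab _ => ?_
    symm
    rw [Finset.sum_filter]
  rw [hD1]
  -- the weight and the coefficients
  set ψ : ℕ × ℕ → ℕ → ℝ := fun ab n =>
    max 0 (Real.log (x / ((ab.1 : ℝ) * n * ab.2))) ^ k / Real.log n with hψ
  set c : ℕ → ℝ := fun p => (g p - (p : ℝ)⁻¹) * Real.log p with hc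
  set coef : ℕ × ℕ → ℝ := fun ab =>
    -((μ ab.1 : ℝ) * μ ab.2) * (((ab.1 : ℕ) : ℝ)⁻¹ * g ab.2) with hcoef
  have hinner : ∀ ab ∈ Ds ×ˢ Ds, ∑ p ∈ Pr.filter (cond ab), F ab.1 p ab.2 =
      coef ab * ∑ p ∈ Pr.filter (cond ab), c p * ψ ab p := by
    intro ab hab
    obtain ⟨ha, hb⟩ := Finset.mem_product.mp hab
    obtain ⟨⟨ha1, -⟩, -, hasf⟩ := hmemDs.mp ha
    obtain ⟨⟨hb1, -⟩, -, hbsf⟩ := hmemDs.mp hb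
    have ha0 : ab.1 ≠ 0 := by omega
    have hb0 : ab.2 ≠ 0 := by omega
    rw [Finset.mul_sum]
    refine Finset.sum_congr rfl fun p hp => ?_
    obtain ⟨hp, hap, hbp, hltY'⟩ := Finset.mem_filter.mp hp
    obtain ⟨-, hpp, -⟩ := hmemPr.mp hp
    have hpa := coprime_of_primeFactors_lt hpp ha0 hap
    have hpb := coprime_of_lt_primeFactors hpp hb0 hbp
    have hab' := coprime_of_primeFactors_lt_lt ha0 hb0 hap hbp
    -- `μ(a p b) = −μ(a) μ(b)`
    have hμ : (μ (ab.1 * p * ab.2) : ℝ) = -((μ ab.1 : ℝ) * μ ab.2) := by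
      have h1 : (ab.1 * p).Coprime ab.2 := Nat.Coprime.mul_left hab' hpb
      rw [ArithmeticFunction.isMultiplicative_moebius.map_mul_of_coprime h1,
        ArithmeticFunction.isMultiplicative_moebius.map_mul_of_coprime hpa,
        ArithmeticFunction.moebius_apply_prime hpp]
      push_cast
      ring
    -- `x / (a p b) ≥ 1`
    have hcast : ((ab.1 * p * ab.2 : ℕ) : ℝ) = (ab.1 : ℝ) * p * ab.2 := by push_cast; ring
    have hapb_pos : (0 : ℝ) < (ab.1 : ℝ) * p * ab.2 := by
      have := hpp.pos; positivity
    have hratio : 1 ≤ x / ((ab.1 : ℝ) * p * ab.2) := by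
      rw [le_div_iff₀ hapb_pos, one_mul, ← hcast]
      exact ((hltY hltY').trans_le hyx).le
    have hmax : max 0 (Real.log (x / ((ab.1 : ℝ) * p * ab.2))) =
        Real.log (x / ((ab.1 : ℝ) * p * ab.2)) := max_eq_right (Real.log_nonneg hratio)
    have hlogp : Real.log p ≠ 0 :=
      (Real.log_pos (by exact_mod_cast hpp.one_lt)).ne'
    rw [hF, hψ, hc, hcoef]
    simp only
    rw [hcast, hμ, hmax]
    field_simp
  -- Step E: Abel summation for each `(a, b)`
  have habel : ∀ ab ∈ Ds ×ˢ Ds, |∑ p ∈ Pr.filter (cond ab), c p * ψ ab p| ≤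
      η * (Real.log x ^ k / Real.log z) := by
    intro ab hab
    obtain ⟨ha, hb⟩ := Finset.mem_product.mp hab
    obtain ⟨⟨ha1, -⟩, -, -⟩ := hmemDs.mp ha
    obtain ⟨⟨hb1, -⟩, -, -⟩ := hmemDs.mp hb
    have hS : ∀ p ∈ Pr.filter (cond ab), ⌈z⌉₊ ≤ p := by
      intro p hp
      obtain ⟨hp, -⟩ := Finset.mem_filter.mp hp
      obtain ⟨-, hpp, hpP⟩ := hmemPr.mp hp
      exact Nat.ceil_le.mpr ((hcopP hpp).mp hpP)
    have hE : ∀ m : ℕ, |∑ p ∈ (Pr.filter (cond ab)).filter (· ≤ m), c p| ≤ η := by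
      intro m
      refine hη _ (fun p hp => ?_) (fun p₁ hp₁ p₃ hp₃ p₂ hp₂ h12 h23 => ?_)
      · obtain ⟨hp, -⟩ := Finset.mem_filter.mp hp
        obtain ⟨hp, -⟩ := Finset.mem_filter.mp hp
        obtain ⟨-, hpp, hpP⟩ := hmemPr.mp hp
        exact ⟨hpp, (hcopP hpp).mp hpP⟩
      · obtain ⟨hp₁, -⟩ := Finset.mem_filter.mp hp₁
        obtain ⟨hp₁, hap₁, -, -⟩ := Finset.mem_filter.mp hp₁
        obtain ⟨-, hp₁p, hp₁P⟩ := hmemPr.mp hp₁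
        obtain ⟨hp₃, hp₃m⟩ := Finset.mem_filter.mp hp₃
        obtain ⟨hp₃, -, hbp₃, hY₃⟩ := Finset.mem_filter.mp hp₃
        obtain ⟨hp₃Y, -, -⟩ := hmemPr.mp hp₃
        have hz₂ : z ≤ (p₂ : ℝ) := ((hcopP hp₁p).mp hp₁P).trans (by exact_mod_cast h12)
        refine Finset.mem_filter.mpr ⟨Finset.mem_filter.mpr ⟨hmemPr.mpr ⟨?_, hp₂, ?_⟩, ?_, ?_, ?_⟩,
          h23.trans hp₃m⟩
        · exact lt_of_le_of_lt h23 hp₃Y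
        · exact (hcopP hp₂).mpr hz₂
        · exact fun q hq => lt_of_lt_of_le (hap₁ q hq) h12
        · exact fun q hq => lt_of_le_of_lt h23 (hbp₃ q hq)
        · exact lt_of_le_of_lt (Nat.mul_le_mul_right _ (Nat.mul_le_mul_left _ h23)) hY₃
    have hψanti : ∀ m n : ℕ, ⌈z⌉₊ ≤ m → m ≤ n → ψ ab n ≤ ψ ab m := by
      intro m n hm hmn
      rw [hψ]
      exact logRatioWeight_antitone hx0 ha1 hb1 k (hm₀2.trans hm) hmn
    have hψ0 : ∀ n : ℕ, ⌈z⌉₊ ≤ n → 0 ≤ ψ ab n := by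
      intro n hn
      rw [hψ]
      have hn1 : (1 : ℝ) ≤ n := by exact_mod_cast (le_trans (by omega : 1 ≤ ⌈z⌉₊) hn)
      exact div_nonneg (pow_nonneg (le_max_left _ _) _) (Real.log_nonneg hn1)
    refine (abs_sum_mul_le_of_antitone (by omega : 1 ≤ ⌈z⌉₊) hS hE hψanti hψ0).trans ?_
    refine mul_le_mul_of_nonneg_left ?_ hη0
    rw [hψ]
    exact logRatioWeight_le hx hz ha1 hb1 hzm₀ k
  -- Step F: combine
  have hcoef_abs : ∀ ab ∈ Ds ×ˢ Ds,
      |coef ab| = (|(μ ab.1 : ℝ)| * ((ab.1 : ℕ) : ℝ)⁻¹) * (|(μ ab.2 : ℝ)| * g ab.2) := by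
    intro ab hab
    obtain ⟨-, hb⟩ := Finset.mem_product.mp hab
    obtain ⟨-, -, hbsf⟩ := hmemDs.mp hb
    have hgb : 0 ≤ g ab.2 := by
      rw [BetaSieve.map_eq_prod_primeFactors hg hbsf]
      exact Finset.prod_nonneg fun p hp => hg0 p (Nat.prime_of_mem_primeFactors hp)
    rw [hcoef]
    simp only
    rw [abs_mul, abs_neg, abs_mul, abs_mul, abs_of_nonneg hgb,
      abs_of_nonneg (show (0 : ℝ) ≤ ((ab.1 : ℕ) : ℝ)⁻¹ from inv_nonneg.mpr (Nat.cast_nonneg _))]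
    ring
  have hW0 : 0 ≤ η * (Real.log x ^ k / Real.log z) :=
    mul_nonneg hη0 (div_nonneg (pow_nonneg hL0 _) hlogz.le)
  calc |∑ ab ∈ Ds ×ˢ Ds, ∑ p ∈ Pr.filter (cond ab), F ab.1 p ab.2|
      = |∑ ab ∈ Ds ×ˢ Ds, coef ab * ∑ p ∈ Pr.filter (cond ab), c p * ψ ab p| := by
        rw [Finset.sum_congr rfl hinner]
    _ ≤ ∑ ab ∈ Ds ×ˢ Ds, |coef ab * ∑ p ∈ Pr.filter (cond ab), c p * ψ ab p| :=
        Finset.abs_sum_le_sum_abs _ _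
    _ ≤ ∑ ab ∈ Ds ×ˢ Ds, (|(μ ab.1 : ℝ)| * ((ab.1 : ℕ) : ℝ)⁻¹) * (|(μ ab.2 : ℝ)| * g ab.2) *
          (η * (Real.log x ^ k / Real.log z)) := by
        refine Finset.sum_le_sum fun ab hab => ?_
        rw [abs_mul, hcoef_abs ab hab]
        exact mul_le_mul_of_nonneg_left (habel ab hab) (by
          rw [← hcoef_abs ab hab]; exact abs_nonneg _)
    _ = η * (Real.log x ^ k / Real.log z) *
          ((∑ a ∈ Ds, |(μ a : ℝ)| * (a : ℝ)⁻¹) * ∑ b ∈ Ds, |(μ b : ℝ)| * g b) := by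
        rw [← Finset.sum_mul, Finset.sum_product, Finset.sum_mul_sum, mul_comm]
    _ ≤ η * (Real.log x ^ k / Real.log z) *
          ((∑ a ∈ D, |(μ a : ℝ)| * (a : ℝ)⁻¹) * ∑ b ∈ D, |(μ b : ℝ)| * g b) := by
        refine mul_le_mul_of_nonneg_left ?_ hW0
        have h1 : ∑ a ∈ Ds, |(μ a : ℝ)| * (a : ℝ)⁻¹ ≤ ∑ a ∈ D, |(μ a : ℝ)| * (a : ℝ)⁻¹ :=
          Finset.sum_le_sum_of_subset_of_nonneg hDs_sub fun a _ _ =>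
            mul_nonneg (abs_nonneg _) (inv_nonneg.mpr (Nat.cast_nonneg _))
        have h2 : ∑ b ∈ Ds, |(μ b : ℝ)| * g b ≤ ∑ b ∈ D, |(μ b : ℝ)| * g b := by
          refine Finset.sum_le_sum_of_subset_of_nonneg hDs_sub fun b hb hbn => ?_
          by_cases hbsf : Squarefree b
          · have hgb : 0 ≤ g b := by
              rw [BetaSieve.map_eq_prod_primeFactors hg hbsf]
              exact Finset.prod_nonneg fun p hp => hg0 p (Nat.prime_of_mem_primeFactors hp)
            exact mul_nonneg (abs_nonneg _) hgb
          · rw [ArithmeticFunction.moebius_eq_zero_of_not_squarefree hbsf, Int.cast_zero,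
              abs_zero, zero_mul]
        have h10 : 0 ≤ ∑ a ∈ Ds, |(μ a : ℝ)| * (a : ℝ)⁻¹ :=
          Finset.sum_nonneg fun a _ => mul_nonneg (abs_nonneg _) (inv_nonneg.mpr (Nat.cast_nonneg _))
        have h20 : 0 ≤ ∑ b ∈ D, |(μ b : ℝ)| * g b := by
          refine Finset.sum_nonneg fun b _ => ?_
          by_cases hbsf : Squarefree b
          · have hgb : 0 ≤ g b := by
              rw [BetaSieve.map_eq_prod_primeFactors hg hbsf]
              exact Finset.prod_nonneg fun p hp => hg0 p (Nat.prime_of_mem_primeFactors hp)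
            exact mul_nonneg (abs_nonneg _) hgb
          · rw [ArithmeticFunction.moebius_eq_zero_of_not_squarefree hbsf, Int.cast_zero,
              abs_zero, zero_mul]
        have h30 : 0 ≤ ∑ b ∈ Ds, |(μ b : ℝ)| * g b := by
          refine Finset.sum_nonneg fun b hb => ?_
          obtain ⟨-, -, hbsf⟩ := hmemDs.mp hb
          have hgb : 0 ≤ g b := by
            rw [BetaSieve.map_eq_prod_primeFactors hg hbsf]
            exact Finset.prod_nonneg fun p hp => hg0 p (Nat.prime_of_mem_primeFactors hp)
          exact mul_nonneg (abs_nonneg _) hgb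
        exact mul_le_mul h1 h2 h30 (h10.trans h1)

end BombieriSieve

end Literature.NumberTheory.Sieve
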